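import Summits.QuantumFields.BalabanUV.T4Continuum.Support.NE7FluxGradOfTanCritical
import Summits.QuantumFields.BalabanUV.T4Continuum.Support.NE7ClassCurrentBound
import HarnessLib

/-!
# NE7ClassFluxGradBound — supplier stub (S-h) of the NE7 crux, part (c6) (ROAD-G108 §4): (10) TYPE UP TO A LOGARITHM FOR OUR TANGENT-CRITICAL CONFIGURATIONS OF THE CLASS, `d = 4`, `L = 2`,
# READ AS ONE `k`-FREE CONSTANT — `‖∇_U F(x; j, π)‖ ≤ C·ε·(2 + k)∕M³` at EVERY bond and plane (`M = 2^{k+1}`), for every tangent-critical `U ∈ admissible (sfClass 4 2 N ε) 2 (k+1) D`,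
# `0 < ε ≤ 10⁻⁵³` (gen 108's `NE7FluxGradOfTanCritical.fluxGrad_le_of_tanCritical` at `m = M`, `a = x = ε∕M²`, its side conditions discharged as in gen 92's `NE7ClassCurrentBound`)

Cell `pub-balaban`, rung (B)+1 sub-cell t4, lineage `b2b-balaban-t4-ne7-p1`, generation 108 (CRUX PROVER NE7 #1 = OWNER of BINDER row NE7).  Memo `t4/b2b-balaban-t4-ne7-p1-g108/ROAD-G108.md` §4 (c).
ARITHMETIC (`M = 2^{k+1} ≥ 2`, `a = ε∕M²`, `m = M`): `1 + log M ≤ 1 + (k+1) = 2 + k`; `a² = ε²∕M⁴ ≤ ε∕M³`; `τ = 5·(4(3M+2))·a ≤ 100ε∕M`, `τa ≤ 100ε∕M³`;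
`T_c = card n(a·(curl1C∕(1−θ_ℓε))·(M⁴∕M²)·E·(2∕16)^{k+1} + 72a²) ≤ card n(2curl1C·E + 72)·ε∕M³` (`M⁴∕M²·(2∕2⁴)^{k+1} = M⁻¹`, gen 92's `geom_identity`; `1 − θ_ℓε ≥ 1∕2`); `2a∕m = 2ε∕M³`.
WHAT ([folklore]; 0 def, 0 sorry).  **`exists_classFluxGradConst`**: `∃ C ≥ 0` ∀ `N ≥ 1`, `0 < ε ≤ 10⁻⁵³`, `D`, `k`, tangent-critical `U ∈ admissible (sfClass 4 2 N ε) 2 (k+1) D`: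
`‖covGrad U (flux U) x j ⟨(μ,ν),h⟩‖ ≤ C·ε·(1 + (k+1))∕(2^{k+1})³` for all `x j` and `μ < ν`.
HONEST FRAMING (page 1): a repackaging of (c5) (elementary lattice analysis of OUR objects at a tangent-critical configuration + row NE7b's flat interior letter); tangent-criticality is a
HYPOTHESIS on `U` (for constrained minimisers over the small data it is gen 90's `tanCritical_of_isMinimiser` + gen 105's (8)∀ — (c7), next file); this is (10) TYPE WITH A LOGARITHM, not
Bałaban's (10); NOT NE3∕NE7; spine 0∕9; finite T⁴ rung (B)+1 — NOT infinite volume, NOT mass gap, NOT BetaPertH, NOT Clay.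
-/

set_option autoImplicit false

open scoped BigOperators Matrix Matrix.Norms.L2Operator
open NormedSpace Finset

namespace Summit.QuantumFields.BalabanUV.T4Continuum.NE7ClassFluxGradBound

open Literature.MathematicalPhysics.QuantumFieldTheory.Balaban1983to89
open B7Prop1Explicit B7Prop2Explicit
open T4AveragingDeficitWall (IsUnitaryCfg IsSkewDir SmallField covGrad flux)
open T4AveragingDeficitWallBoundary (IsPeriodicCfg periodBox)
open AveragingDeficitPeriodicCounting (IsPeriodicDir)
open AveragingDeficitMultiLevelPrep (LevelSmall TangentIter)
open AveragingDeficitTwoLevelPrep (twoLevelSmall)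
open BlockAverageVaryHolo (nbRad)
open MinimalActionLevels (perWin)
open MinimalActionSandwich (admissible)
open MinimalActionRate (sfClass)
open NE3HessForm (dAction)
open NE3TangentCovariantTower (dirIter tangentIter_iff_dirIter_eq_zero)
open NE3QbarIterCovLiftPrep (cruxC)
open NE3RightInverseSolveLetters (thetaLoc cruxC_le_thetaLoc cruxC_nonneg)
open NE3HatInvCurlLetters (curl1C curl1C_nonneg)
open NE7ConvOneStepSU2 (levelSmall_all_d4_L2)
open NE7RoutePiRegimeSU2 (thetaLoc_mul_lt_one thetaLoc_4_2_lt)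
open NE7ClassCurrentBound (geom_identity)
open NE7FluxGradOfTanCritical (fluxGrad_le_of_tanCritical)

noncomputable section

variable {n : Type*} [Fintype n] [DecidableEq n]

set_option maxHeartbeats 800000 in
/-- **(10) TYPE UP TO A LOGARITHM FOR OUR TANGENT-CRITICAL CONFIGURATIONS OF THE CLASS, `d = 4`, `L = 2`** (statement and arithmetic in the file header). [folklore] -/
theorem exists_classFluxGradConst [Nonempty n] :
    ∃ C : ℝ, 0 ≤ C ∧ ∀ (N : ℕ) [NeZero N] (ε : ℝ), 0 < ε → ε ≤ 1 / 10 ^ 53 →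
      ∀ (D : Site 4 → Fin 4 → (Matrix n n ℂ)ˣ) (k : ℕ), ∀ U ∈ admissible (sfClass 4 2 N ε) 2 (k + 1) D,
      (∀ φ : Site 4 → Fin 4 → Matrix n n ℂ, IsSkewDir φ → IsPeriodicDir φ ((N * 2 ^ (k + 1) : ℕ) : ℤ) → TangentIter 2 k U φ →
        dAction U φ (perWin 4 (N * 2 ^ (k + 1))) = 0) →
      ∀ (x₀ : Site 4) (j μ ν : Fin 4) (h : μ < ν),
        ‖covGrad U (flux U) x₀ j ⟨(μ, ν), h⟩‖ ≤ C * ε * (1 + ((k + 1 : ℕ) : ℝ)) / (((2 : ℕ) : ℝ) ^ (k + 1)) ^ 3 := by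
  obtain ⟨C, hC, hletter⟩ := fluxGrad_le_of_tanCritical (d := 4) (n := n) (by norm_num)
  -- the exponential constant of gen 91 at `d = 4`, `L = 2`
  set E : ℝ := Real.exp ((((2 : ℕ) : ℝ) ^ 4 / ((2 : ℕ) : ℝ)) * (((4 : ℕ) : ℝ) * (16 * (((4 : ℕ) : ℝ) + 1) * (((4 : ℕ) : ℝ) + 4) * ((2 : ℕ) : ℝ) ^ 2)
      * (1250 * ((nbRad 4 2 : ℝ) + ((2 : ℕ) : ℝ)) + 8 * (((4 : ℕ) : ℝ) * ((2 : ℕ) : ℝ)) + 2 * ((2 : ℕ) : ℝ))) * (2 / twoLevelSmall 4 2)) with hE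
  have hE0 : 0 ≤ E := (Real.exp_pos _).le
  have hc0 := curl1C_nonneg 4 2
  -- the constant: `C·(248 + 1200 + 2(card n(2curl1C·E + 72) + 1600) + 2) + 400`
  refine ⟨C * (248 + 1200 + 2 * ((Fintype.card n : ℝ) * (2 * curl1C 4 2 * E + 72) + 1600) + 2) + 400, by positivity, ?_⟩
  intro N _ ε hε hε' D k U hU hcrit x₀ j μ ν hμν
  -- names and class data
  have hM0 : (0 : ℝ) < ((2 : ℕ) : ℝ) ^ (k + 1) := by positivity
  have hM2 : (2 : ℝ) ≤ ((2 : ℕ) : ℝ) ^ (k + 1) := by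
    have : ((2 : ℕ) : ℝ) ^ 1 ≤ ((2 : ℕ) : ℝ) ^ (k + 1) := pow_le_pow_right₀ (by norm_num) (by omega)
    norm_num at this ⊢; exact this
  set M : ℝ := ((2 : ℕ) : ℝ) ^ (k + 1) with hMdef
  have hM1 : 1 ≤ M := by linarith
  have hUu : IsUnitaryCfg U := hU.1.1
  have hUP : IsPeriodicCfg U ((N * 2 ^ (k + 1) : ℕ) : ℤ) := hU.1.2.1
  have hUx : SmallField U (ε / M ^ 2) := hU.1.2.2
  have hx : 0 ≤ ε / M ^ 2 := by positivity
  have hs : LevelSmall 4 2 k (ε / M ^ 2) := levelSmall_all_d4_L2 hε.le (hε'.trans (by norm_num)) k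
  have hMx : M ^ 2 * (ε / M ^ 2) = ε := by field_simp
  have hθl : thetaLoc 4 2 * (M ^ 2 * (ε / M ^ 2)) < 1 := by rw [hMx]; exact thetaLoc_mul_lt_one hε hε'
  have hθ : cruxC 4 2 * (M ^ 2 * (ε / M ^ 2)) < 1 := by
    rw [hMx]; exact lt_of_le_of_lt (mul_le_mul_of_nonneg_right (cruxC_le_thetaLoc 4 2) hε.le) (thetaLoc_mul_lt_one hε hε')
  have hε1' : ε ≤ 1 := hε'.trans (by norm_num)
  have hε1 : M ^ 2 * (ε / M ^ 2) ≤ 1 := by rw [hMx]; exact hε1'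
  have ha50 : ε / M ^ 2 ≤ 1 / 50 := by
    rw [div_le_iff₀ (by positivity)]
    nlinarith [one_le_pow₀ (M₀ := ℝ) (a := M) hM1 (n := 2), hε']
  have hcrit' : ∀ Y' : Site 4 → Fin 4 → Matrix n n ℂ, IsSkewDir Y' → IsPeriodicDir Y' ((N * 2 ^ (k + 1) : ℕ) : ℤ) →
      dirIter 2 (k + 1) U Y' = 0 → dAction U Y' (perWin 4 (N * 2 ^ (k + 1))) = 0 :=
    fun Y' h1 h2 h3 => hcrit Y' h1 h2 ((tangentIter_iff_dirIter_eq_zero 2 k U Y').2 h3)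
  -- the scale `m := 2^{k+1}`
  have hmM : ((2 ^ (k + 1) : ℕ) : ℝ) = M := by rw [hMdef]; push_cast; ring
  have hm1 : 1 ≤ 2 ^ (k + 1) := Nat.one_le_two_pow
  -- THE LETTER at `a = x = ε/M²`, `m = M`
  have h := hletter (L := 2) (le_refl 2) k (N := N) hUu hUP hx hs hUx hθ hθl hε1 hx ha50 hUx hcrit' (2 ^ (k + 1)) hm1 x₀ j μ ν hμν
  rw [hmM, ← hE, ← hMdef] at h
  refine h.trans ?_
  -- the arithmetic
  set a : ℝ := ε / M ^ 2 with ha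
  have ha0 : 0 ≤ a := hx
  -- `1 + log M ≤ 2 + k`
  have hlog : 1 + Real.log M ≤ 1 + ((k + 1 : ℕ) : ℝ) := by
    rw [hMdef, Real.log_pow]
    have h2 : Real.log ((2 : ℕ) : ℝ) ≤ 1 := by
      have := Real.log_le_sub_one_of_pos (show (0 : ℝ) < ((2 : ℕ) : ℝ) by norm_num); norm_num at this ⊢; linarith
    have hk : (0 : ℝ) ≤ ((k + 1 : ℕ) : ℝ) := by positivity
    have := mul_le_mul_of_nonneg_left h2 hk
    linarith
  have hlog0 : 0 ≤ 1 + Real.log M := by have := Real.log_nonneg hM1; linarith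
  have hk0' : (0 : ℝ) ≤ ((k + 1 : ℕ) : ℝ) := by positivity
  have hk1 : (1 : ℝ) ≤ 1 + ((k + 1 : ℕ) : ℝ) := by linarith
  -- `a² ≤ ε·(ε/M³) ≤ ε/M³`, `a = ε/M²`, `τ ≤ 100 ε/M`
  have hM3 : 0 < M ^ 3 := by positivity
  have haM : a = ε / M ^ 2 := rfl
  have ha2 : a ^ 2 ≤ ε / M ^ 3 := by
    rw [haM, div_pow, div_le_div_iff₀ (by positivity) hM3]
    have h1 : ε ^ 2 ≤ ε := by nlinarith
    have h2 : M ^ 3 ≤ (M ^ 2) ^ 2 := by nlinarith [pow_le_pow_right₀ hM1 (show 3 ≤ 4 by norm_num)]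
    calc ε ^ 2 * M ^ 3 ≤ ε * M ^ 3 := by nlinarith [hM3]
      _ ≤ ε * (M ^ 2) ^ 2 := by nlinarith [hε.le]
  set τ : ℝ := ((((4 + 1) * (4 * (3 * 2 ^ (k + 1) + 2)) : ℕ) : ℝ) * a) with hτ
  have hτle : τ ≤ 100 * ε / M := by
    rw [hτ, haM]
    have e1 : ((((4 + 1) * (4 * (3 * 2 ^ (k + 1) + 2)) : ℕ)) : ℝ) = 20 * (3 * M + 2) := by rw [hMdef]; push_cast; ring
    rw [e1, show 20 * (3 * M + 2) * (ε / M ^ 2) = (20 * (3 * M + 2) * ε) / M ^ 2 by ring, div_le_div_iff₀ (by positivity) hM0]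
    have : 3 * M + 2 ≤ 5 * M := by linarith
    have hεM : 0 ≤ ε * M := by positivity
    calc 20 * (3 * M + 2) * ε * M = 20 * (3 * M + 2) * (ε * M) := by ring
      _ ≤ 20 * (5 * M) * (ε * M) := by nlinarith
      _ = 100 * ε * M ^ 2 := by ring
  have hτ0 : 0 ≤ τ := by rw [hτ]; positivity
  have hτa : τ * a ≤ 100 * (ε / M ^ 3) := by
    have h1 : τ * a ≤ (100 * ε / M) * (ε / M ^ 2) := by rw [← haM]; exact mul_le_mul_of_nonneg_right hτle ha0
    have e : (100 * ε / M) * (ε / M ^ 2) = 100 * (ε * (ε / M ^ 3)) := by field_simp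
    rw [e] at h1
    have h2 : ε * (ε / M ^ 3) ≤ 1 * (ε / M ^ 3) := mul_le_mul_of_nonneg_right hε1' (by positivity)
    linarith
  -- the tension constant: main term `≤ 2 curl1C E ε/M³`, `a²`-term
  have hgeom : M ^ 4 / M ^ 2 * ((((2 : ℕ) : ℝ)) / ((2 : ℕ) : ℝ) ^ 4) ^ (k + 1) = 1 / M := by rw [hMdef]; exact geom_identity k
  have hθε : 1 - thetaLoc 4 2 * ε ≥ 1 / 2 := by
    have h0 : 0 ≤ thetaLoc 4 2 := (cruxC_nonneg 4 2).trans (cruxC_le_thetaLoc 4 2)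
    have h1 : thetaLoc 4 2 * ε ≤ 10 ^ 19 * (1 / 10 ^ 53) := mul_le_mul thetaLoc_4_2_lt.le hε' hε.le (by norm_num)
    norm_num at h1 ⊢; linarith
  have hmain : (a * ((curl1C 4 2 / (1 - thetaLoc 4 2 * (M ^ 2 * (ε / M ^ 2)))) * (M ^ 4 / M ^ 2))) * (E * ((((2 : ℕ) : ℝ)) / ((2 : ℕ) : ℝ) ^ 4) ^ (k + 1))
      ≤ 2 * curl1C 4 2 * E * (ε / M ^ 3) := by
    rw [hMx, haM]
    have e1 : (ε / M ^ 2 * ((curl1C 4 2 / (1 - thetaLoc 4 2 * ε)) * (M ^ 4 / M ^ 2))) * (E * ((((2 : ℕ) : ℝ)) / ((2 : ℕ) : ℝ) ^ 4) ^ (k + 1))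
        = (curl1C 4 2 / (1 - thetaLoc 4 2 * ε)) * E * (ε / M ^ 2 * (M ^ 4 / M ^ 2 * ((((2 : ℕ) : ℝ)) / ((2 : ℕ) : ℝ) ^ 4) ^ (k + 1))) := by ring
    rw [e1, hgeom, show ε / M ^ 2 * (1 / M) = ε / M ^ 3 by rw [div_mul_div_comm, mul_one, ← pow_succ]]
    have h2 : curl1C 4 2 / (1 - thetaLoc 4 2 * ε) ≤ 2 * curl1C 4 2 := by
      rw [div_le_iff₀ (by linarith)]; nlinarith
    have h3 : 0 ≤ ε / M ^ 3 := by positivity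
    have := mul_le_mul_of_nonneg_right (mul_le_mul_of_nonneg_right h2 hE0) h3
    linarith
  have hcard : (0 : ℝ) ≤ (Fintype.card n : ℝ) := Nat.cast_nonneg _
  have hP6 : (Fintype.card (T4AveragingDeficitWall.Plane 4) : ℝ) = 6 := by
    rw [show Fintype.card (T4AveragingDeficitWall.Plane 4) = 6 from by rfl]; norm_num
  have hTc : (Fintype.card n : ℝ) * ((a * ((curl1C 4 2 / (1 - thetaLoc 4 2 * (M ^ 2 * (ε / M ^ 2)))) * (M ^ 4 / M ^ 2)))
        * (E * ((((2 : ℕ) : ℝ)) / ((2 : ℕ) : ℝ) ^ 4) ^ (k + 1)) + 12 * (Fintype.card (T4AveragingDeficitWall.Plane 4) : ℝ) * a ^ 2)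
      ≤ (Fintype.card n : ℝ) * (2 * curl1C 4 2 * E + 72) * (ε / M ^ 3) := by
    rw [hP6]
    have t := add_le_add hmain (mul_le_mul_of_nonneg_left ha2 (by norm_num : (0 : ℝ) ≤ 12 * 6))
    have := mul_le_mul_of_nonneg_left t hcard
    have e : (Fintype.card n : ℝ) * (2 * curl1C 4 2 * E + 72) * (ε / M ^ 3) = (Fintype.card n : ℝ) * (2 * curl1C 4 2 * E * (ε / M ^ 3) + 12 * 6 * (ε / M ^ 3)) := by ring
    rw [e]; exact this
  -- assemble: every bracket term `≤ (const)·ε/M³`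
  have hQ : 248 * a ^ 2 + 12 * τ * a
        + 2 * ((Fintype.card n : ℝ) * ((a * ((curl1C 4 2 / (1 - thetaLoc 4 2 * (M ^ 2 * (ε / M ^ 2)))) * (M ^ 4 / M ^ 2)))
            * (E * ((((2 : ℕ) : ℝ)) / ((2 : ℕ) : ℝ) ^ 4) ^ (k + 1)) + 12 * (Fintype.card (T4AveragingDeficitWall.Plane 4) : ℝ) * a ^ 2)
          + 4 * ((4 : ℕ) : ℝ) * τ * a)
      ≤ (248 + 1200 + 2 * ((Fintype.card n : ℝ) * (2 * curl1C 4 2 * E + 72) + 1600)) * (ε / M ^ 3) := by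
    have t1 : 248 * a ^ 2 ≤ 248 * (ε / M ^ 3) := by linarith
    have t2 : 12 * τ * a ≤ 1200 * (ε / M ^ 3) := by linarith [hτa]
    have t3 : 4 * ((4 : ℕ) : ℝ) * τ * a ≤ 1600 * (ε / M ^ 3) := by push_cast; linarith [hτa]
    linarith [hTc, t1, t2, t3]
  have hQ0 : 0 ≤ 248 * a ^ 2 + 12 * τ * a
        + 2 * ((Fintype.card n : ℝ) * ((a * ((curl1C 4 2 / (1 - thetaLoc 4 2 * (M ^ 2 * (ε / M ^ 2)))) * (M ^ 4 / M ^ 2)))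
            * (E * ((((2 : ℕ) : ℝ)) / ((2 : ℕ) : ℝ) ^ 4) ^ (k + 1)) + 12 * (Fintype.card (T4AveragingDeficitWall.Plane 4) : ℝ) * a ^ 2)
          + 4 * ((4 : ℕ) : ℝ) * τ * a) := by
    have hpos : 0 < 1 - thetaLoc 4 2 * (M ^ 2 * (ε / M ^ 2)) := by linarith
    positivity
  have hεM3 : 0 ≤ ε / M ^ 3 := by positivity
  -- the final inequality
  have e3 : (C * (248 + 1200 + 2 * ((Fintype.card n : ℝ) * (2 * curl1C 4 2 * E + 72) + 1600) + 2) + 400) * ε * (1 + ((k + 1 : ℕ) : ℝ)) / M ^ 3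
      = (1 + ((k + 1 : ℕ) : ℝ)) * (C * ((248 + 1200 + 2 * ((Fintype.card n : ℝ) * (2 * curl1C 4 2 * E + 72) + 1600)) * (ε / M ^ 3)) + C * (2 * (ε / M ^ 3)))
        + (1 + ((k + 1 : ℕ) : ℝ)) * (400 * (ε / M ^ 3)) := by
    ring
  rw [e3]
  have s1 : C * ((1 + Real.log M) * (248 * a ^ 2 + 12 * τ * a
          + 2 * ((Fintype.card n : ℝ) * ((a * ((curl1C 4 2 / (1 - thetaLoc 4 2 * (M ^ 2 * (ε / M ^ 2)))) * (M ^ 4 / M ^ 2)))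
              * (E * ((((2 : ℕ) : ℝ)) / ((2 : ℕ) : ℝ) ^ 4) ^ (k + 1)) + 12 * (Fintype.card (T4AveragingDeficitWall.Plane 4) : ℝ) * a ^ 2)
            + 4 * ((4 : ℕ) : ℝ) * τ * a)) + 2 * a / M)
      ≤ (1 + ((k + 1 : ℕ) : ℝ)) * (C * ((248 + 1200 + 2 * ((Fintype.card n : ℝ) * (2 * curl1C 4 2 * E + 72) + 1600)) * (ε / M ^ 3)) + C * (2 * (ε / M ^ 3))) := by
    have h2a : 2 * a / M = 2 * (ε / M ^ 3) := by rw [haM]; field_simp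
    rw [h2a]
    have u1 := mul_le_mul hlog hQ hQ0 (by positivity)
    have u2 : C * ((1 + Real.log M) * (248 * a ^ 2 + 12 * τ * a
          + 2 * ((Fintype.card n : ℝ) * ((a * ((curl1C 4 2 / (1 - thetaLoc 4 2 * (M ^ 2 * (ε / M ^ 2)))) * (M ^ 4 / M ^ 2)))
              * (E * ((((2 : ℕ) : ℝ)) / ((2 : ℕ) : ℝ) ^ 4) ^ (k + 1)) + 12 * (Fintype.card (T4AveragingDeficitWall.Plane 4) : ℝ) * a ^ 2)
            + 4 * ((4 : ℕ) : ℝ) * τ * a)) + 2 * (ε / M ^ 3))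
        ≤ C * ((1 + ((k + 1 : ℕ) : ℝ)) * ((248 + 1200 + 2 * ((Fintype.card n : ℝ) * (2 * curl1C 4 2 * E + 72) + 1600)) * (ε / M ^ 3)) + 2 * (ε / M ^ 3)) :=
      mul_le_mul_of_nonneg_left (by linarith) hC
    have hCk : C * (2 * (ε / M ^ 3)) ≤ (1 + ((k + 1 : ℕ) : ℝ)) * (C * (2 * (ε / M ^ 3))) := le_mul_of_one_le_left (by positivity) hk1
    have e4 : C * ((1 + ((k + 1 : ℕ) : ℝ)) * ((248 + 1200 + 2 * ((Fintype.card n : ℝ) * (2 * curl1C 4 2 * E + 72) + 1600)) * (ε / M ^ 3)) + 2 * (ε / M ^ 3))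
        = (1 + ((k + 1 : ℕ) : ℝ)) * (C * ((248 + 1200 + 2 * ((Fintype.card n : ℝ) * (2 * curl1C 4 2 * E + 72) + 1600)) * (ε / M ^ 3))) + C * (2 * (ε / M ^ 3)) := by
      ring
    rw [e4] at u2
    have e5 : (1 + ((k + 1 : ℕ) : ℝ)) * (C * ((248 + 1200 + 2 * ((Fintype.card n : ℝ) * (2 * curl1C 4 2 * E + 72) + 1600)) * (ε / M ^ 3)) + C * (2 * (ε / M ^ 3)))
        = (1 + ((k + 1 : ℕ) : ℝ)) * (C * ((248 + 1200 + 2 * ((Fintype.card n : ℝ) * (2 * curl1C 4 2 * E + 72) + 1600)) * (ε / M ^ 3)))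
          + (1 + ((k + 1 : ℕ) : ℝ)) * (C * (2 * (ε / M ^ 3))) := by ring
    rw [e5]
    linarith
  have s2 : 4 * τ * a ≤ (1 + ((k + 1 : ℕ) : ℝ)) * (400 * (ε / M ^ 3)) := by
    have : 4 * τ * a ≤ 400 * (ε / M ^ 3) := by linarith [hτa]
    exact this.trans (le_mul_of_one_le_left (by positivity) hk1)
  linarith

end

end Summit.QuantumFields.BalabanUV.T4Continuum.NE7ClassFluxGradBound
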